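import Summits.BirchSwinnertonDyer.BirchSwinnertonDyer.Theorems.ByReductionTypeAtTwoFineSelmerConjAAtTwoAdditivePotGoodExplicitMinkowski
import Summits.BirchSwinnertonDyer.BirchSwinnertonDyer.Theorems.ByReductionTypeAtTwoFineSelmerConjAAtTwoAdditivePotGoodPresentationDoor
import HarnessLib

/-!
# Route `ByReductionTypeAtTwo` (rung K4), crux C1″ `FineSelmerConjAAtTwoAdditivePotGood` (item stmt-BirchSwinnertonDyer-22615):
# CLASS NUMBER ONE FOR THE CUBIC FIELD OF DISCRIMINANT `−780` (`X³ − X² − X − 5`) BY AN EXPLICIT MINKOWSKI CERTIFICATE (KERNEL),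
# hence Iwasawa's `μ₂ = 0` for it UNCONDITIONALLY — the `2`-torsion field of the census row `294060j1`
# (a `--supports 22615` file; seat `bsd-2adic-k4-w1` GEN 4; first consumer of `…ExplicitMinkowski`)

HONEST FRAMING (cell `bsd-2adic`, D-0036/D-0054): UNCONDITIONAL kernel theorems (§1–§3); closes nothing at the `∀`-level; nothing
booked; BSD is not proved by any of this.

THE CERTIFICATE (found by a search over `x + yθ + zθ²`, `|x|,|y|,|z| ≤ 6`, norms computed as companion determinants; verified here by the
kernel). `g = X³ − X² − X − 5`, `disc g = −780` (so `|d_K| ≤ 780`, `M_K ≤ (4/3.14)(6/27)√780 < 8`); `g` is irreducible (no root mod `7`).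
Every prime ideal `I` with `N(I) ≤ 7` is principal:
* `N(I) ∈ {2, 4}`: `2 ∈ I` and `g ≡ (X − 1)³ (mod 2)` give `θ − 1 ∈ I`, so `α₂ = −2 − θ − θ² = −(θ − 1)(θ + 2) − 4 ∈ I` with `N(α₂) = −2`:
  `I = (α₂)` if `N(I) = 2`, and `N(I) = 4` is impossible (`N(I) ∣ N(α₂)`).
* `N(I) = 3`: `θ ≡ a ∈ {1, 2}` (`3 ∤ g(0) = −5`): `a = 1`: `α = θ² − θ − 3 = (θ − 1)θ − 3 ∈ I`, `N = 3`; `a = 2`: `α = θ − 2`, `N = 3`.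
* `N(I) = 5`: `θ ≡ a ∈ {0, 3}`: `a = 0`: `α = −θ`, `N = −5`; `a = 3`: `α = 2θ² − 3θ − 4 = (θ − 3)(2θ + 3) + 5`, `N = −5`.
* `N(I) = 6`: impossible (`2 ∈ I ⟹ N(I) ∣ 8`, `3 ∈ I ⟹ N(I) ∣ 27`).  * `N(I) = 7`: impossible (`g` has no root mod `7`).

* §1 `irreducible_cubic_of_no_root_zmod` (generic: no root mod a prime `ℓ` ⟹ irreducible over `ℚ`), `irreducible_cubic_disc_neg780`.
* §2 **`classNumber_eq_one_of_root_disc_neg780`**: any cubic number field containing a root of `g` has `h = 1`.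
* §3 `ℚ(θ)`: `card_classGroup_adjoin_eq_one_disc_neg780`; **`classicalMuVanishes_cubicField_disc_neg780`**: `μ₂ = 0` along EVERY
  `ℤ₂`-extension of `ℚ(θ)`, `θ³ = θ² + θ + 5` — UNCONDITIONAL (one prime above `2`: `θ − 1` is a root of the Eisenstein cubic
  `X³ + 2X² − 6`… precisely `X³ + 2X² + 0·X − 6`; `…EisensteinDoor` + `adjoin_shift_eq`).

References: [Marcus1977] Ch. 5, Thm. 35–37 and examples; [Cohen1993] §6.3, App. B; [Greenberg2001IwasawaPastPresent] Prop. 2.1.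
-/

set_option autoImplicit false
-- sibling precedent (`…ExplicitMinkowski.lean`): the directory name repeats the summit name
set_option linter.dupNamespace false

noncomputable section

open scoped Classical IntermediateField NumberField Real nonZeroDivisors

namespace Summit.BirchSwinnertonDyer.BirchSwinnertonDyer.Theorems.AddKatoTwo

open Polynomial IsDedekindDomain NumberField Matrix Literature.NumberTheory.EllipticCurves Literature.NumberTheory.IwasawaTheory

/-! ## §1 Irreducibility from a root-free reduction -/

/-- **A monic integer cubic with no root modulo a prime `ℓ` is irreducible over `ℚ`** (irreducible over `𝔽_ℓ` as a root-free cubic,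
hence over `ℤ`, hence over `ℚ` by Gauss). [folklore] -/
theorem irreducible_cubic_of_no_root_zmod (ℓ : ℕ) {p q r : ℤ}
    (h : ∀ x : ZMod ℓ, x ^ 3 + (p : ZMod ℓ) * x ^ 2 + (q : ZMod ℓ) * x + (r : ZMod ℓ) ≠ 0) [Fact ℓ.Prime] :
    Irreducible (Cubic.toPoly ⟨1, (p : ℚ), q, r⟩) := by
  have hirrl : Irreducible (Cubic.toPoly ⟨1, (p : ZMod ℓ), q, r⟩) := by
    have hnd : (Cubic.toPoly ⟨(1 : ZMod ℓ), p, q, r⟩).natDegree = 3 := Cubic.natDegree_of_a_ne_zero' one_ne_zero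
    rw [Polynomial.irreducible_iff_roots_eq_zero_of_degree_le_three (by rw [hnd]; norm_num) (by rw [hnd]),
      Multiset.eq_zero_iff_forall_notMem]
    intro x hx
    rw [mem_roots ((Cubic.monic_of_a_eq_one' (b := (p : ZMod ℓ)) (c := (q : ZMod ℓ)) (d := (r : ZMod ℓ))).ne_zero),
      IsRoot.def] at hx
    simp only [Cubic.toPoly, map_one, one_mul, eval_add, eval_mul, eval_C, eval_pow, eval_X] at hx
    exact h x hx
  have hZ : Irreducible (Cubic.toPoly ⟨1, p, q, r⟩) := by
    refine Polynomial.Monic.irreducible_of_irreducible_map (Int.castRingHom (ZMod ℓ)) _ Cubic.monic_of_a_eq_one' ?_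
    rw [← Cubic.map_toPoly]
    simpa [Cubic.map] using hirrl
  have hQ := ((Cubic.monic_of_a_eq_one' (b := p) (c := q) (d := r)).irreducible_iff_irreducible_map_fraction_map
    (K := ℚ)).mp hZ
  rw [← Cubic.map_toPoly] at hQ
  simpa [Cubic.map] using hQ

/-- `X³ − X² − X − 5` is irreducible over `ℚ` (no root mod `7`). -/
theorem irreducible_cubic_disc_neg780 : Irreducible (Cubic.toPoly ⟨1, ((-1 : ℤ) : ℚ), ((-1 : ℤ) : ℚ), ((-5 : ℤ) : ℚ)⟩) :=
  haveI : Fact (Nat.Prime 7) := ⟨by norm_num⟩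
  irreducible_cubic_of_no_root_zmod 7 (by decide)

/-! ## §2 The certificate: `h = 1` -/

section Certificate

variable (K : Type) [Field K] [NumberField K]

/-- The companion-determinant norms of the four generators `−2 − θ − θ²`, `θ² − θ − 3`, `θ − 2`, `−θ`, `2θ² − 3θ − 4`
of the field of `X³ − X² − X − 5`: `−2, 3, 3, −5, −5`. -/
private theorem dets_disc_neg780 :
    (((-2 : ℤ) : ℚ) • (1 : Matrix (Fin 3) (Fin 3) ℚ) + ((-1 : ℤ) : ℚ) • !![(0 : ℚ), 0, -(-5 : ℤ); 1, 0, -(-1 : ℤ); 0, 1, -(-1 : ℤ)] +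
        ((-1 : ℤ) : ℚ) • !![(0 : ℚ), 0, -(-5 : ℤ); 1, 0, -(-1 : ℤ); 0, 1, -(-1 : ℤ)] ^ 2).det = -2 ∧
    (((-3 : ℤ) : ℚ) • (1 : Matrix (Fin 3) (Fin 3) ℚ) + ((-1 : ℤ) : ℚ) • !![(0 : ℚ), 0, -(-5 : ℤ); 1, 0, -(-1 : ℤ); 0, 1, -(-1 : ℤ)] +
        ((1 : ℤ) : ℚ) • !![(0 : ℚ), 0, -(-5 : ℤ); 1, 0, -(-1 : ℤ); 0, 1, -(-1 : ℤ)] ^ 2).det = 3 ∧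
    (((-2 : ℤ) : ℚ) • (1 : Matrix (Fin 3) (Fin 3) ℚ) + ((1 : ℤ) : ℚ) • !![(0 : ℚ), 0, -(-5 : ℤ); 1, 0, -(-1 : ℤ); 0, 1, -(-1 : ℤ)] +
        ((0 : ℤ) : ℚ) • !![(0 : ℚ), 0, -(-5 : ℤ); 1, 0, -(-1 : ℤ); 0, 1, -(-1 : ℤ)] ^ 2).det = 3 ∧
    (((0 : ℤ) : ℚ) • (1 : Matrix (Fin 3) (Fin 3) ℚ) + ((-1 : ℤ) : ℚ) • !![(0 : ℚ), 0, -(-5 : ℤ); 1, 0, -(-1 : ℤ); 0, 1, -(-1 : ℤ)] +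
        ((0 : ℤ) : ℚ) • !![(0 : ℚ), 0, -(-5 : ℤ); 1, 0, -(-1 : ℤ); 0, 1, -(-1 : ℤ)] ^ 2).det = -5 ∧
    (((-4 : ℤ) : ℚ) • (1 : Matrix (Fin 3) (Fin 3) ℚ) + ((-3 : ℤ) : ℚ) • !![(0 : ℚ), 0, -(-5 : ℤ); 1, 0, -(-1 : ℤ); 0, 1, -(-1 : ℤ)] +
        ((2 : ℤ) : ℚ) • !![(0 : ℚ), 0, -(-5 : ℤ); 1, 0, -(-1 : ℤ); 0, 1, -(-1 : ℤ)] ^ 2).det = -5 := by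
  refine ⟨?_, ?_, ?_, ?_, ?_⟩
  · simp [Matrix.det_fin_three, sq]; norm_num
  · simp [Matrix.det_fin_three, sq]; norm_num
  · simp [Matrix.det_fin_three, sq]; norm_num
  · simp [Matrix.det_fin_three, sq]
  · simp [Matrix.det_fin_three, sq]; norm_num

/-- **`h = 1` for every cubic number field containing a root `θ` of `X³ − X² − X − 5`** (the field of discriminant `−780`), by the
explicit Minkowski certificate of the module docstring. KERNEL. [cite: Marcus1977, Ch. 5 Thm. 37 and Cor. 2]
[cite: Cohen1993, App. B (complex cubic fields: d = −780, h = 1)] -/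
theorem classNumber_eq_one_of_root_disc_neg780 (h3 : Module.finrank ℚ K = 3) (b : 𝓞 K)
    (hb : b ^ 3 + (-1 : ℤ) * b ^ 2 + (-1 : ℤ) * b + (-5 : ℤ) = 0) : NumberField.classNumber K = 1 := by
  have hirr := irreducible_cubic_disc_neg780
  have hd : |NumberField.discr K| ≤ (780 : ℕ) :=
    (abs_discr_le_abs_cubic_discr K h3 b hirr hb).trans (by simp only [Cubic.discr]; norm_num)
  have hM := minkowskiBound_lt_of_sqrt_le K h3 hd (s := 27.93) (B := 8)
    ((Real.sqrt_le_sqrt (by norm_num : ((780 : ℕ) : ℝ) ≤ (27.93 : ℝ) ^ 2)).trans (Real.sqrt_sq (by norm_num)).le)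
    (by norm_num)
  obtain ⟨hN2, hN3a, hN3b, hN5a, hN5b⟩ := dets_disc_neg780
  have hb' : b ^ 3 - b ^ 2 - b - 5 = 0 := by push_cast at hb; linear_combination hb
  rw [NumberField.classNumber_eq_one_iff]
  refine RingOfIntegers.isPrincipalIdealRing_of_isPrincipal_of_norm_le_of_isPrime fun I hI hle ↦ ?_
  have hlt : Ideal.absNorm (I : Ideal (𝓞 K)) < 8 := by exact_mod_cast hle.trans_lt hM
  have h0 : Ideal.absNorm (I : Ideal (𝓞 K)) ≠ 0 := Ideal.absNorm_ne_zero_of_nonZeroDivisors I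
  have h1 : Ideal.absNorm (I : Ideal (𝓞 K)) ≠ 1 := by rw [Ne, Ideal.absNorm_eq_one_iff]; exact hI.ne_top
  have hmemN := Ideal.absNorm_mem (I : Ideal (𝓞 K))
  -- norms of the generators
  have nα2 := natAbs_norm_coords_eq K h3 b hirr hb (-2) (-1) (-1) (n := 2) hN2 (by norm_num)
  have nα3a := natAbs_norm_coords_eq K h3 b hirr hb (-3) (-1) 1 (n := 3) hN3a (by norm_num)
  have nα3b := natAbs_norm_coords_eq K h3 b hirr hb (-2) 1 0 (n := 3) hN3b (by norm_num)
  have nα5a := natAbs_norm_coords_eq K h3 b hirr hb 0 (-1) 0 (n := 5) hN5a (by norm_num)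
  have nα5b := natAbs_norm_coords_eq K h3 b hirr hb (-4) (-3) 2 (n := 5) hN5b (by norm_num)
  -- `2 ∈ I ⟹ θ - 1 ∈ I ⟹ α₂ ∈ I`
  have key2 : ((2 : ℕ) : 𝓞 K) ∈ (I : Ideal (𝓞 K)) →
      (((-2 : ℤ) : 𝓞 K) + ((-1 : ℤ) : 𝓞 K) * b + ((-1 : ℤ) : 𝓞 K) * b ^ 2) ∈ (I : Ideal (𝓞 K)) := by
    intro h2
    have hb1 : b - 1 ∈ (I : Ideal (𝓞 K)) := by
      apply hI.mem_of_pow_mem 3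
      have : (b - 1) ^ 3 = ((2 : ℕ) : 𝓞 K) * (-(b ^ 2 - 2 * b - 2)) := by push_cast; linear_combination hb'
      rw [this]; exact Ideal.mul_mem_right _ _ h2
    have : (((-2 : ℤ) : 𝓞 K) + ((-1 : ℤ) : 𝓞 K) * b + ((-1 : ℤ) : 𝓞 K) * b ^ 2) =
        (b - 1) * (-(b + 2)) + ((2 : ℕ) : 𝓞 K) * (-2) := by push_cast; ring
    rw [this]
    exact Ideal.add_mem _ (Ideal.mul_mem_right _ _ hb1) (Ideal.mul_mem_right _ _ h2)
  have h2le : 2 ≤ Ideal.absNorm (I : Ideal (𝓞 K)) := by omega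
  interval_cases hn : Ideal.absNorm (I : Ideal (𝓞 K))
  · -- N(I) = 2
    have h2 : ((2 : ℕ) : 𝓞 K) ∈ (I : Ideal (𝓞 K)) := hmemN
    exact ⟨⟨_, eq_span_singleton_of_mem_of_absNorm_eq K two_ne_zero hn (key2 h2) nα2⟩⟩
  · -- N(I) = 3
    have h3m : ((3 : ℕ) : 𝓞 K) ∈ (I : Ideal (𝓞 K)) := hmemN
    obtain ⟨a, ha, hab⟩ := exists_sub_natCast_mem_of_absNorm_eq_prime K (by norm_num) hn b
    have hdvd := natCast_dvd_of_sub_mem K (by norm_num) hn h3 hb hab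
    interval_cases a
    · norm_num at hdvd
    · refine ⟨⟨_, eq_span_singleton_of_mem_of_absNorm_eq K (by norm_num) hn ?_ nα3a⟩⟩
      have : (((-3 : ℤ) : 𝓞 K) + ((-1 : ℤ) : 𝓞 K) * b + ((1 : ℤ) : 𝓞 K) * b ^ 2) =
          (b - ((1 : ℕ) : 𝓞 K)) * b + ((3 : ℕ) : 𝓞 K) * (-1) := by push_cast; ring
      rw [this]; exact Ideal.add_mem _ (Ideal.mul_mem_right _ _ hab) (Ideal.mul_mem_right _ _ h3m)
    · refine ⟨⟨_, eq_span_singleton_of_mem_of_absNorm_eq K (by norm_num) hn ?_ nα3b⟩⟩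
      have : (((-2 : ℤ) : 𝓞 K) + ((1 : ℤ) : 𝓞 K) * b + ((0 : ℤ) : 𝓞 K) * b ^ 2) = b - ((2 : ℕ) : 𝓞 K) := by
        push_cast; ring
      rw [this]; exact hab
  · -- N(I) = 4: `2 ∈ I`, so `α₂ ∈ I` and `4 ∣ 2`
    exfalso
    have h4 : ((4 : ℕ) : 𝓞 K) ∈ (I : Ideal (𝓞 K)) := hmemN
    have h2 : ((2 : ℕ) : 𝓞 K) ∈ (I : Ideal (𝓞 K)) := by
      have : ((4 : ℕ) : 𝓞 K) = ((2 : ℕ) : 𝓞 K) * ((2 : ℕ) : 𝓞 K) := by push_cast; norm_num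
      rw [this] at h4
      exact (hI.mem_or_mem h4).elim id id
    have hdvd := Ideal.absNorm_dvd_absNorm_of_le ((Ideal.span_singleton_le_iff_mem _).mpr (key2 h2))
    rw [Ideal.absNorm_span_singleton, nα2, hn] at hdvd
    omega
  · -- N(I) = 5
    have h5m : ((5 : ℕ) : 𝓞 K) ∈ (I : Ideal (𝓞 K)) := hmemN
    obtain ⟨a, ha, hab⟩ := exists_sub_natCast_mem_of_absNorm_eq_prime K (by norm_num) hn b
    have hdvd := natCast_dvd_of_sub_mem K (by norm_num) hn h3 hb hab
    interval_cases a
    · refine ⟨⟨_, eq_span_singleton_of_mem_of_absNorm_eq K (by norm_num) hn ?_ nα5a⟩⟩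
      have : (((0 : ℤ) : 𝓞 K) + ((-1 : ℤ) : 𝓞 K) * b + ((0 : ℤ) : 𝓞 K) * b ^ 2) = (b - ((0 : ℕ) : 𝓞 K)) * (-1) := by
        push_cast; ring
      rw [this]; exact Ideal.mul_mem_right _ _ hab
    · norm_num at hdvd
    · norm_num at hdvd
    · refine ⟨⟨_, eq_span_singleton_of_mem_of_absNorm_eq K (by norm_num) hn ?_ nα5b⟩⟩
      have : (((-4 : ℤ) : 𝓞 K) + ((-3 : ℤ) : 𝓞 K) * b + ((2 : ℤ) : 𝓞 K) * b ^ 2) =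
          (b - ((3 : ℕ) : 𝓞 K)) * (2 * b + 3) + ((5 : ℕ) : 𝓞 K) * 1 := by push_cast; ring
      rw [this]; exact Ideal.add_mem _ (Ideal.mul_mem_right _ _ hab) (Ideal.mul_mem_right _ _ h5m)
    · norm_num at hdvd
  · -- N(I) = 6: impossible
    exfalso
    have h6 : ((6 : ℕ) : 𝓞 K) ∈ (I : Ideal (𝓞 K)) := hmemN
    have : ((6 : ℕ) : 𝓞 K) = ((2 : ℕ) : 𝓞 K) * ((3 : ℕ) : 𝓞 K) := by push_cast; norm_num
    rw [this] at h6
    rcases hI.mem_or_mem h6 with h | h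
    · have := absNorm_dvd_pow_three_of_natCast_mem K h3 h; rw [hn] at this; omega
    · have := absNorm_dvd_pow_three_of_natCast_mem K h3 h; rw [hn] at this; omega
  · -- N(I) = 7: impossible (no root mod 7)
    exfalso
    obtain ⟨a, ha, hab⟩ := exists_sub_natCast_mem_of_absNorm_eq_prime K (by norm_num) hn b
    have hdvd := natCast_dvd_of_sub_mem K (by norm_num) hn h3 hb hab
    interval_cases a <;> norm_num at hdvd

end Certificate

/-! ## §3 `ℚ(θ)`: class number one and UNCONDITIONAL `μ₂ = 0` -/

section Adjoin

/-- `#Cl(𝓞 ℚ(θ)) = 1` for every root `θ` of `X³ − X² − X − 5`. KERNEL. [cite: Cohen1993, App. B (d = −780)] -/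
theorem card_classGroup_adjoin_eq_one_disc_neg780 {θ : AlgebraicClosure ℚ}
    (hθ : aeval θ (Cubic.toPoly ⟨1, ((-1 : ℤ) : ℚ), ((-1 : ℤ) : ℚ), ((-5 : ℤ) : ℚ)⟩) = 0) :
    Nat.card (ClassGroup (𝓞 (IntermediateField.adjoin ℚ {θ}))) = 1 := by
  have hfm : (Cubic.toPoly ⟨1, ((-1 : ℤ) : ℚ), ((-1 : ℤ) : ℚ), ((-5 : ℤ) : ℚ)⟩).Monic := Cubic.monic_of_a_eq_one'
  have hθint : IsIntegral ℚ θ := ⟨_, hfm, by rwa [← aeval_def]⟩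
  haveI : FiniteDimensional ℚ (IntermediateField.adjoin ℚ {θ}) := IntermediateField.adjoin.finiteDimensional hθint
  haveI : NumberField (IntermediateField.adjoin ℚ {θ}) := NumberField.mk
  obtain ⟨b, -, hb⟩ := exists_ringOfIntegers_cubic_root (p := -1) (q := -1) (r := -5) hθ
  have h1 := classNumber_eq_one_of_root_disc_neg780 _
    (finrank_adjoin_eq_three_of_irreducible irreducible_cubic_disc_neg780 hθ) b hb
  rw [NumberField.classNumber, ← Nat.card_eq_fintype_card] at h1
  exact h1

/-- **Iwasawa's `μ₂ = 0` for the cubic field of discriminant `−780`** (`ℚ(θ)`, `θ³ = θ² + θ + 5`; `2 = 𝔭³` since `θ − 1` is a root of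
the Eisenstein cubic `X³ + 2X² − 6`, `h = 1` by §2): along EVERY `ℤ₂`-extension of `ℚ(θ)`, UNCONDITIONAL.
[cite: Greenberg2001IwasawaPastPresent, Prop. 2.1 p. 339] [cite: Cohen1993, App. B (d = −780)] -/
theorem classicalMuVanishes_cubicField_disc_neg780 {θ : AlgebraicClosure ℚ}
    (hθ : aeval θ (Cubic.toPoly ⟨1, ((-1 : ℤ) : ℚ), ((-1 : ℤ) : ℚ), ((-5 : ℤ) : ℚ)⟩) = 0)
    (κ : ZpExtension (IntermediateField.adjoin ℚ {θ}) 2) : ClassicalMuVanishes κ := by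
  refine classicalMuVanishes_two_adjoin_of_unique_prime θ (by rw [card_classGroup_adjoin_eq_one_disc_neg780 hθ]; norm_num) ?_ κ
  -- one prime above 2: the translate `θ - 1` is an Eisenstein generator of the same field
  have hroot : aeval (θ + algebraMap ℚ (AlgebraicClosure ℚ) ((-1 : ℤ) : ℚ))
      (Cubic.toPoly ⟨1, ((2 : ℤ) : ℚ), ((0 : ℤ) : ℚ), ((-6 : ℤ) : ℚ)⟩) = 0 := by
    have := aeval_cubic_shift_int (p := -1) (q := -1) (r := -5) (-1) hθ
    norm_num at this ⊢
    exact this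
  have h := existsUnique_two_mem_adjoin_of_eisenstein (p := 2) (q := 0) (r := -6) (by decide) (by decide) (by decide)
    (by decide) hroot
  rwa [adjoin_shift_eq] at h

end Adjoin

end Summit.BirchSwinnertonDyer.BirchSwinnertonDyer.Theorems.AddKatoTwo

end
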